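import Mathlib
import Summits.NavierStokesRegularity.NavierStokesRegularity.Theorems.TaoLadderRungTwoBreakBlowupRigidityOneOneHopTables
import HarnessLib

/-!
# One-hop tables with an ABSORBING dead set: the rotor hypothesis (H3) of `…BlowupRigidityOneOneHopTables` weakened
  to `Q(V_D) ⊆ V_D` — still no Theorem-4.2-level blow-up at any scale ratio from any one-shell datum
  (`--supports stmt-NavierStokesRegularity-20206`, K2(1) `TaoLadderRungTwoBreak.BlowupRigidityOne`)

MODEL lattice ODEs only (Tao 2016 §4 (4.1)–(4.3), Lemma 4.1 (4.5)–(4.8), (4.12), Thm. 4.2 statement shape; §5);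
nothing here is a statement about the Navier–Stokes equations; NO item is closed.  DEF-FREE; ROUTE-INDEPENDENT.

The sibling file proved: a cancelling table with (H1) outflow lands in `D`, (H2) `D`-states do not emit, (H3) rotor
lands in `D` (for ALL inputs) carries a global exact two-shell flow from every one-shell datum.  (H3) was only used to
keep the modes `i ∉ D` of shell `1` dark.  Here the reduced system is solved directly on `ℝ^m ⊕ ℝ^D` (shell `1`
restricted to the coordinates in `D`; the tool `exists_solution_of_sum_mul_eq_zero` works on any finite index type,
and the reduced field is energy-neutral with NO hypothesis), so (H3) weakens to the absorbing condition

  (H3′) `α_{jk i,(0,0,0)} = 0` for `j, k ∈ D`, `i ∉ D`   — the rotor does not move a `D`-supported state out of `V_D`,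

which is exactly what the exact law on the dark modes of shell `1` requires (this discharges the sibling file's
`TODO(general form)`).

* `sum_extendD_mul`, `extendD_of_not_mem`, `tableQ_extendD_eq_zero` — bookkeeping for the zero-extension
  `ℝ^D → ℝ^m`;
* `exists_regularExactFlow_of_oneHop_absorbing`, `not_noGlobalCascade_of_oneHop_absorbing` — global exact
  (4.5)-regular lattice flow from every one-shell datum, hence no robust blow-up on `E₂(R)` (every `ε₀ > 0`, every
  datum), for cancelling tables with (H1), (H2), (H3′).

HONEST LABEL: calibration of one aside leaf on an explicit sub-class; no stub, crux, rung or summit is proved; rung 0.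
-/

noncomputable section

-- the summit and its single sub-problem share the name (CONVENTIONS §1)
set_option linter.dupNamespace false

open Set Filter Topology MeasureTheory
open scoped RealInnerProductSpace

namespace Summit.NavierStokesRegularity.NavierStokesRegularity.Theorems

namespace BlowupRigidityOne

open Literature.Analysis.FluidPDE Literature.Analysis.FluidPDE.TaoCascade
  Literature.Analysis.FluidPDE.Tao2016AveragedNS

variable {m : ℕ} {R ε₀ : ℝ} {α : Fin m → Fin m → Fin m → ℤ × ℤ × ℤ → ℝ}

/-! ## The zero-extension `ℝ^D → ℝ^m` -/

/-- Pairing a vector with the zero-extension of `w : D → ℝ` only sees the coordinates in `D`: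
`Σ_i f_i · (ext w)_i = Σ_{d ∈ D} f_d w_d`. [elementary] -/
theorem sum_extendD_mul (D : Finset (Fin m)) (f : Fin m → ℝ) (w : ↥D → ℝ) :
    ∑ i, f i * (fun i => if h : i ∈ D then w ⟨i, h⟩ else 0) i = ∑ d : ↥D, f d.1 * w d := by
  classical
  rw [← Finset.sum_subset (Finset.subset_univ D) (fun i _ hi => by simp [hi]), ← Finset.sum_coe_sort]
  refine Finset.sum_congr rfl fun d _ => ?_
  simp [d.2]

/-- Off `D` the zero-extension vanishes. [elementary] -/
theorem extendD_of_not_mem (D : Finset (Fin m)) (w : ↥D → ℝ) {i : Fin m} (hi : i ∉ D) :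
    (fun i => if h : i ∈ D then w ⟨i, h⟩ else 0) i = 0 := by
  simp [hi]

/-- Under (H3′) the rotor keeps a `D`-supported state inside `V_D`: `Q(y)_i = 0` for `i ∉ D` if `y_j = 0` off `D`.
[cite: Tao2016AveragedNS, §4 (4.1), Lemma 4.1 (4.8); cell vocabulary (absorbing hypothesis (H3′))] -/
theorem tableQ_apply_eq_zero_of_supported {D : Finset (Fin m)}
    (hQD : ∀ j k i, j ∈ D → k ∈ D → i ∉ D → α j k i ((0 : ℤ), (0 : ℤ), (0 : ℤ)) = 0)
    {y : Em m} (hy : ∀ i, i ∉ D → y i = 0) {i : Fin m} (hi : i ∉ D) : tableQ α y i = 0 := by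
  simp only [tableQ_apply, qform]
  refine Finset.sum_eq_zero fun j _ => Finset.sum_eq_zero fun k _ => ?_
  by_cases hj : j ∈ D
  · by_cases hk : k ∈ D
    · rw [hQD j k i hj hk hi, zero_mul]
    · rw [hy k hk, mul_zero, mul_zero]
  · rw [hy j hj, zero_mul, mul_zero]

/-- Under (H1) the outflow of any state has no component off `D`. [cite: Tao2016AveragedNS, §4 (4.1); cell vocabulary ((H1))] -/
theorem tableA_apply_eq_zero_of_lands {D : Finset (Fin m)}
    (hAD : ∀ j k i, i ∉ D → α j k i ((0 : ℤ), (0 : ℤ), (1 : ℤ)) = 0) (x : Em m) {i : Fin m} (hi : i ∉ D) :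
    tableA α x i = 0 := by
  simp only [tableA_apply, qform]
  exact Finset.sum_eq_zero fun j _ => Finset.sum_eq_zero fun k _ => by rw [hAD j k i hi, zero_mul]

/-! ## The reduced two-shell field on `ℝ^m ⊕ ℝ^D` and the global exact flow -/

/-- **ONE-HOP TABLES WITH AN ABSORBING DEAD SET FLOW GLOBALLY AND EXACTLY.**  Let `α` be cancelling with (H1) outflow
lands in `D`, (H2) `D`-states do not emit, (H3′) `Q(V_D) ⊆ V_D`.  For every `ε₀`, horizon `T` and one-shell datum
`X₀` at shell `0` there is an EXACT lattice flow on `[0,T]` with the a priori weight (4.5): the global trajectory of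
the reduced field `(x, y_D) ↦ (Q x + B(ȳ, x), (Λ₁ Q ȳ + A x)|_D)` (`ȳ` = zero-extension of `y_D`; energy-neutral for
EVERY cancelling table) put on shells `0, 1`, zero elsewhere; (H1)+(H3′) make the dark modes of shell `1` obey the
law, (H2) freezes shell `2`.
[cite: Tao2016AveragedNS, §4 Lemma 4.1 (4.5), (4.7), (4.8), (4.12); §5 p. 25] -/
theorem exists_regularExactFlow_of_oneHop_absorbing (hc : IsCancellingCoeff α) {D : Finset (Fin m)}
    (hAD : ∀ j k i, i ∉ D → α j k i ((0 : ℤ), (0 : ℤ), (1 : ℤ)) = 0)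
    (hDD : ∀ j k i, j ∈ D → k ∈ D → α j k i ((0 : ℤ), (0 : ℤ), (1 : ℤ)) = 0)
    (hQD : ∀ j k i, j ∈ D → k ∈ D → i ∉ D → α j k i ((0 : ℤ), (0 : ℤ), (0 : ℤ)) = 0)
    (ε₀ : ℝ) (X₀ : Fin m → ℝ) (T : ℝ) :
    ∃ X : Fin m → ℤ → ℝ → ℝ,
      (∀ i k, X i k 0 = if k = 0 then X₀ i else 0) ∧
      (∀ i k, ∀ t ∈ Icc 0 T, HasDerivWithinAt (X i k) (quadTerm ε₀ α X i k t) (Icc 0 T) t) ∧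
      ∃ M : ℝ, ∀ t ∈ Icc 0 T, ∀ (i : Fin m) (k : ℤ),
        (1 + (1 + ε₀) ^ ((10 : ℝ) * k)) * |X i k t| ≤ M := by
  classical
  set Λ₁ : ℝ := (1 + ε₀) ^ ((5 : ℝ) / 2) with hΛ₁
  -- zero-extension and the reduced field
  set ext : (↥D → ℝ) → (Fin m → ℝ) := fun w i => if h : i ∈ D then w ⟨i, h⟩ else 0 with hext
  set G : (Fin m ⊕ ↥D → ℝ) → (Fin m ⊕ ↥D → ℝ) := fun Z => Sum.elim
        (fun i => (tableQ α (WithLp.toLp 2 fun j => Z (Sum.inl j)) +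
          tableB α (WithLp.toLp 2 (ext fun d => Z (Sum.inr d))) (WithLp.toLp 2 fun j => Z (Sum.inl j))) i)
        (fun d => (Λ₁ • tableQ α (WithLp.toLp 2 (ext fun d => Z (Sum.inr d))) +
          tableA α (WithLp.toLp 2 fun j => Z (Sum.inl j))) d.1) with hG
  -- energy neutrality (no hypothesis on the table beyond cancellation)
  have hGc : ∀ Z, ∑ s, G Z s * Z s = 0 := by
    intro Z
    have hST := table_sTable α hc
    set x : Em m := WithLp.toLp 2 fun j => Z (Sum.inl j) with hx
    set y : Em m := WithLp.toLp 2 (ext fun d => Z (Sum.inr d)) with hy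
    rw [Fintype.sum_sum_type]
    simp only [hG, Sum.elim_inl, Sum.elim_inr]
    have h1 : ∑ i, (tableQ α x + tableB α y x) i * Z (Sum.inl i) = ⟪x, tableQ α x⟫ + ⟪x, tableB α y x⟫ := by
      rw [inner_eq_sum_mul, inner_eq_sum_mul, ← Finset.sum_add_distrib]
      refine Finset.sum_congr rfl fun i _ => ?_
      simp only [PiLp.add_apply, hx, PiLp.toLp_apply]
      ring
    have h2 : ∑ d : ↥D, (Λ₁ • tableQ α y + tableA α x) d.1 * Z (Sum.inr d) =
        Λ₁ * ⟪y, tableQ α y⟫ + ⟪y, tableA α x⟫ := by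
      rw [← sum_extendD_mul D (fun i => (Λ₁ • tableQ α y + tableA α x) i) (fun d => Z (Sum.inr d)),
        inner_eq_sum_mul, inner_eq_sum_mul, Finset.mul_sum, ← Finset.sum_add_distrib]
      refine Finset.sum_congr rfl fun i _ => ?_
      simp only [PiLp.add_apply, PiLp.smul_apply, smul_eq_mul, hy, PiLp.toLp_apply, hext]
      ring
    rw [h1, h2, hST.intra x, hST.intra y]
    have hcancel := hST.cancel x y
    linarith
  -- smoothness (polynomial field)
  have hG' : ContDiff ℝ 1 G := by
    refine contDiff_pi.2 fun s => ?_
    rcases s with i | d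
    · simp only [hG, Sum.elim_inl, PiLp.add_apply, tableQ_apply, tableB_apply, qform, hext]
      refine ContDiff.add (by fun_prop) (ContDiff.add ?_ ?_) <;>
        refine ContDiff.sum fun j _ => ContDiff.sum fun k _ => ?_ <;> split_ifs <;> fun_prop
    · simp only [hG, Sum.elim_inr, PiLp.add_apply, PiLp.smul_apply, smul_eq_mul, tableQ_apply, tableA_apply,
        qform, hext]
      refine ContDiff.add (ContDiff.mul contDiff_const ?_) (by fun_prop)
      refine ContDiff.sum fun j _ => ContDiff.sum fun k _ => ?_
      split_ifs <;> fun_prop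
  set z₀ : Fin m ⊕ ↥D → ℝ := Sum.elim X₀ (fun _ => 0) with hz₀
  obtain ⟨Z, hZ0, hZ, hZb⟩ := exists_solution_of_sum_mul_eq_zero G hGc hG' z₀
  -- the shell paths: shell 0 = x, shell 1 = zero-extension of the reduced coordinates
  set x : ℝ → Fin m → ℝ := fun t j => Z t (Sum.inl j) with hx
  set y : ℝ → Fin m → ℝ := fun t => ext fun d => Z t (Sum.inr d) with hy
  have hy0 : ∀ t i, i ∉ D → y t i = 0 := fun t i hi => by simp [hy, hext, hi]
  have hxd : ∀ t i, HasDerivAt (fun t => x t i)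
      ((tableQ α (WithLp.toLp 2 (x t)) + tableB α (WithLp.toLp 2 (y t)) (WithLp.toLp 2 (x t))) i) t := by
    intro t i
    have h := (hasDerivAt_pi.1 (hZ t)) (Sum.inl i)
    simpa [hG] using h
  have hyd : ∀ t i, HasDerivAt (fun t => y t i)
      ((Λ₁ • tableQ α (WithLp.toLp 2 (y t)) + tableA α (WithLp.toLp 2 (x t))) i) t := by
    intro t i
    by_cases hi : i ∈ D
    · have h := (hasDerivAt_pi.1 (hZ t)) (Sum.inr ⟨i, hi⟩)
      have hfun : (fun t => y t i) = fun t => Z t (Sum.inr ⟨i, hi⟩) := by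
        funext t; simp [hy, hext, hi]
      rw [hfun]
      simpa [hG] using h
    · have hfun : (fun t => y t i) = fun _ => (0 : ℝ) := by funext t; exact hy0 t i hi
      have hzero : (Λ₁ • tableQ α (WithLp.toLp 2 (y t)) + tableA α (WithLp.toLp 2 (x t))) i = 0 := by
        rw [PiLp.add_apply, PiLp.smul_apply, smul_eq_mul,
          tableQ_apply_eq_zero_of_supported hQD (fun j hj => by simp [hy0 t j hj]) hi,
          tableA_apply_eq_zero_of_lands hAD _ hi, mul_zero, add_zero]
      rw [hfun, hzero]
      exact hasDerivAt_const t 0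
  have hAy : ∀ t, tableA α (WithLp.toLp 2 (y t)) = 0 := fun t =>
    tableA_eq_zero_of_supported hDD fun i hi => by simp [hy0 t i hi]
  -- amplitude bounds from the energy
  have hbx : ∀ t i, |x t i| ≤ Real.sqrt (∑ r, z₀ r ^ 2) := fun t i => hZb t (Sum.inl i)
  have hby : ∀ t i, |y t i| ≤ Real.sqrt (∑ r, z₀ r ^ 2) := by
    intro t i
    by_cases hi : i ∈ D
    · have h := hZb t (Sum.inr ⟨i, hi⟩)
      have : y t i = Z t (Sum.inr ⟨i, hi⟩) := by simp [hy, hext, hi]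
      rwa [this]
    · rw [hy0 t i hi, abs_zero]; exact Real.sqrt_nonneg _
  -- the lattice family
  refine ⟨fun i k t => if k = 0 then x t i else if k = 1 then y t i else 0, fun i k => ?_, fun i k t _ => ?_,
    ⟨(2 + |(1 + ε₀) ^ ((10 : ℝ) * ((1 : ℤ) : ℝ))|) * Real.sqrt (∑ r, z₀ r ^ 2), fun t _ i k => ?_⟩⟩
  · -- datum
    by_cases hk : k = 0
    · subst hk
      simp only [if_true]
      show Z 0 (Sum.inl i) = X₀ i
      rw [hZ0, hz₀, Sum.elim_inl]
    · by_cases hk1 : k = 1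
      · subst hk1
        simp only [one_ne_zero, if_false, if_true]
        by_cases hi : i ∈ D
        · have : y 0 i = Z 0 (Sum.inr ⟨i, hi⟩) := by simp [hy, hext, hi]
          rw [this, hZ0, hz₀, Sum.elim_inr]
        · exact hy0 0 i hi
      · simp [hk, hk1]
  · -- exact motion on every shell
    rw [quadTerm_twoShell]
    by_cases hk : k = 0
    · subst hk
      simp only [if_true]
      exact (hxd t i).hasDerivWithinAt
    · by_cases hk1 : k = 1
      · subst hk1
        simp only [one_ne_zero, if_false, if_true]
        exact (hyd t i).hasDerivWithinAt
      · by_cases hk2 : k = 2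
        · subst hk2
          simp only [show ((2 : ℤ) = 0) ↔ False by decide, show ((2 : ℤ) = 1) ↔ False by decide, if_false,
            if_true, hAy t, PiLp.zero_apply, mul_zero]
          exact hasDerivWithinAt_const _ _ _
        · simp only [hk, hk1, hk2, if_false]
          exact hasDerivWithinAt_const _ _ _
  · -- a priori weight (4.5)
    by_cases hk : k = 0
    · subst hk
      simp only [if_true, Int.cast_zero, mul_zero, Real.rpow_zero]
      have h2 : (1 + 1 : ℝ) ≤ 2 + |(1 + ε₀) ^ ((10 : ℝ) * ((1 : ℤ) : ℝ))| := by
        linarith [abs_nonneg ((1 + ε₀) ^ ((10 : ℝ) * ((1 : ℤ) : ℝ)))]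
      exact mul_le_mul h2 (hbx t i) (abs_nonneg _) (by positivity)
    · by_cases hk1 : k = 1
      · subst hk1
        simp only [one_ne_zero, if_false, if_true]
        have h2 : 1 + (1 + ε₀) ^ ((10 : ℝ) * ((1 : ℤ) : ℝ)) ≤ 2 + |(1 + ε₀) ^ ((10 : ℝ) * ((1 : ℤ) : ℝ))| := by
          linarith [le_abs_self ((1 + ε₀) ^ ((10 : ℝ) * ((1 : ℤ) : ℝ)))]
        by_cases hw : 0 ≤ 1 + (1 + ε₀) ^ ((10 : ℝ) * ((1 : ℤ) : ℝ))
        · exact mul_le_mul h2 (hby t i) (abs_nonneg _) (by positivity)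
        · push Not at hw
          exact le_trans (mul_nonpos_of_nonpos_of_nonneg hw.le (abs_nonneg _)) (by positivity)
      · simp only [hk, hk1, if_false, abs_zero, mul_zero]
        positivity

/-- **NO ROBUST BLOW-UP ON A ONE-HOP TABLE WITH AN ABSORBING DEAD SET.**  If `α ∈ E₂(R)` satisfies (H1), (H2), (H3′)
for some `D`, then `¬ NoGlobalCascade ε₀ α X₀` for every `ε₀ > 0` and every one-shell datum `X₀`
(`noRegularExactFlow_of_noGlobalCascade` against the global exact flow above).
[cite: Tao2016AveragedNS, §4 Thm. 4.2 (statement shape), Lemma 4.1 (4.5)–(4.8), §5 p. 25; cell vocabulary (`NoGlobalCascade`)] -/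
theorem not_noGlobalCascade_of_oneHop_absorbing (hε : 0 < ε₀) (hα : InTableClass R α) {D : Finset (Fin m)}
    (hAD : ∀ j k i, i ∉ D → α j k i ((0 : ℤ), (0 : ℤ), (1 : ℤ)) = 0)
    (hDD : ∀ j k i, j ∈ D → k ∈ D → α j k i ((0 : ℤ), (0 : ℤ), (1 : ℤ)) = 0)
    (hQD : ∀ j k i, j ∈ D → k ∈ D → i ∉ D → α j k i ((0 : ℤ), (0 : ℤ), (0 : ℤ)) = 0) (X₀ : Fin m → ℝ) :
    ¬ NoGlobalCascade ε₀ α X₀ := by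
  intro hNG
  obtain ⟨T, _, hno⟩ := noRegularExactFlow_of_noGlobalCascade hε hα hNG
  exact hno (exists_regularExactFlow_of_oneHop_absorbing hα.2.1 hAD hDD hQD ε₀ X₀ T)

end BlowupRigidityOne

end Summit.NavierStokesRegularity.NavierStokesRegularity.Theorems

end
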